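import Summits.QuantumFields.BalabanUV.Beta.EriceRemainderEnclosureHistoryAutonomyThresholdWitness
import Summits.QuantumFields.BalabanUV.Beta.EriceRemainderEnclosureHistoryAutonomyExistence

/-!
# EriceRemainderEnclosureHistoryAutonomyThresholdEdgeUnstable — (E47e) ABOVE THE THRESHOLD THE SOLUTION SET IS UPPER BUT NOT LOWER SEMICONTINUOUS:
# raising (E38c)'s Markov tent functional `φ_y` (`9∕10 ≤ y < 1`, two box solutions `hSlow`, `hF_y` from the pin `1`) by ANY constant `η > 0` leaves NO box
# solution near `hSlow` — every box solution `h′` of the flow of `φ_y + η` from the pin `1` has `√3·h′(1) < y`, so `hSlow(1) − h′(1) > (1 − y)∕√3` however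
# small `η` is: the EDGE solution `hSlow` (through the right edge `1∕√3` of the tent, where the scale-1 step equation touches zero from one side) is
# destroyed by an arbitrarily small perturbation of the functional, while (E47a) `abs_sub_le_usc_modulus` keeps every perturbed solution within
# `γ(1 − 1∕q)₊ + √(γF∕q)` of the unperturbed solution SET — the set-valued solution map is upper semicontinuous with a rate and NOT lower semicontinuous

Cell `pub-balaban`, β-function sub-cell, BINDER row D4 «RemainderConst leaves for Bałaban's split» (`HOME/BINDER-OWNERS.md`; owner lineage `b2b-balaban-beta-an4`;
this file by co-owner #2 lineage `b2b-balaban-beta-d4-p2`, generation 42), β-FLOW TEAM duty (1), FREEZE (0) honoured (def-free: the shifted tent is an explicit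
lambda in every statement; (E38c)'s `abs_tent_sub_tent_le` ∕ `sqrt3_mul_hSlow_one` ∕ `memFlow_hSlow_tentφ`, node U2's `hSlow`, (E40)'s `exists_memFlow_zm` BY NAME).
Companion of (E47a) `…ThresholdModulus` §4 (upper semicontinuity with a rate at every ratio; not imported) inside the station (E47).

HONEST FRAMING (page 1, verbatim and binding).  *"Discharging BetaPertH makes Bałaban's UV stability UNCONDITIONAL — a real constructive-QFT result; it is
NOT the continuum limit and NOT the Clay problem."*  THIS FILE DISCHARGES NOTHING OF THE KIND.  A kernel TOY family of Markov functionals on ]0,1] and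
elementary real analysis; whether Bałaban's limit functional is Markov, which constants it has and on which side of the threshold it sits is NOT PRINTED
([I] p. 298) and not asserted.  Row D4 class UNCHANGED (critical-path width 0; instance 0∕1; D4 DISCHARGE NO DATE).  HONEST DEPENDENCY: continuum YM on
T⁴ ⇐ BetaPertH ∧ nine spine estimates (0/9 proved); BetaPertH ⇐ (D1) ∧ (D4) ∧ CAP+tail; G-an2-4 gates asym, D1 and NE2/3/4.

THE MECHANISM.  `γ = 1`, `b = 2`, pin `1`, functional `u ↦ 2 + η + max(3∕y² − 3 − 3(1+y)∕y²·|√3·u₀ − y|, 0)`.  In `s = √3·h(1)` the scale-1 step equation is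
`3∕s² − 3 − η = tent_y(s)`; on `[y, 1]` the tent is the chord `k(1 − s)`, `k = 3(1+y)∕y²`, and `3∕s² − 3 ≤ k(1 − s)` there (`(1+s)∕s² ≤ (1+y)∕y²` for `s ≥ y`:
the convex `3∕s² − 3` lies below its chord between its zeros `y` and `1` relative to the tent) — so `η > 0` admits NO root in `[y, 1]`: every box solution
of the raised flow has `√3·h(1) < y` (§2), at distance `> (1−y)∕√3` from `hSlow(1) = 1∕√3` (§3).  At `η = 0` the root `s = 1` exists ((E38c)) but is
ONE-SIDED: `3∕s² − 3 − k(1−s) ↑ 0` as `s ↑ 1` — the edge solution is not continuable upwards in the functional.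

WHAT IS PROVED ([folklore]; 0 `def`, 0 sorry).  §1 `two_le_tentη`, `abs_tentη_sub_le`, `zerothMoment_tentη`, `abs_tentη_sub_tent` (`= η`), `exists_solution_tentη`.
§2 `step_one_tentη`, `sqrt3_mul_lt_one`, `tent_eq_chord`, **`chord_ge`** (`y ≤ s ≤ 1 ⟹ 3∕s² − 3 ≤ 3(1+y)(1−s)∕y²`), **`sqrt3_mul_lt_of_shift`** (`η > 0 ⟹ √3·h(1) < y`).
§3 ENDs: **`hSlow_sub_gt_of_shift`** (`hSlow 1 − h(1) > (1 − y)∕√3`), **`not_lsc_at_tent`** (for EVERY `η > 0` there is a box solution of the raised flow, and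
ALL of them stay `(1−y)∕√3`-away from `hSlow` at scale 1, while `hSlow` solves the unraised flow and the functionals are `η`-close on the box).
-/

noncomputable section
open Filter Topology Finset

namespace Summit.QuantumFields.BalabanUV.Beta.EriceRemainderEnclosureHistoryAutonomyThresholdEdgeUnstable

open Literature.MathematicalPhysics.QuantumFieldTheory.Balaban1983to89
open Literature.MathematicalPhysics.QuantumFieldTheory.Balaban1983to89.T4BetaStationary
open Literature.MathematicalPhysics.QuantumFieldTheory.Balaban1983to89.T4BetaFlowWellPosed
open Literature.MathematicalPhysics.QuantumFieldTheory.Balaban1983to89.T4BetaFlowWellPosed.Sharpness (hSlow seqBox_hSlow)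
open Summit.QuantumFields.BalabanUV.Beta.EriceRemainderEnclosureHistoryAutonomyThresholdWitness
  (abs_tent_sub_tent_le sqrt3_mul_hSlow_one memFlow_hSlow_tentφ)
open Summit.QuantumFields.BalabanUV.Beta.EriceRemainderEnclosureHistoryAutonomyExistence (exists_memFlow_zm)

variable {y η : ℝ} {h : ℕ → ℝ}

/-! ## §1 The raised tent functional -/

/-- FLOOR `2` (`η ≥ 0`). [folklore] -/
theorem two_le_tentη (hη : 0 ≤ η) (y : ℝ) (u : ℕ → ℝ) :
    2 ≤ 2 + η + max (3 / y ^ 2 - 3 - 3 * (1 + y) / y ^ 2 * |Real.sqrt 3 * u 0 - y|) 0 := by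
  have : 0 ≤ max (3 / y ^ 2 - 3 - 3 * (1 + y) / y ^ 2 * |Real.sqrt 3 * u 0 - y|) 0 := le_max_right _ _
  linarith

/-- MARKOV LIPSCHITZ CONSTANT `L_y = 3√3(1+y)∕y²`, independent of the shift ((E38c) `abs_tent_sub_tent_le`). [folklore] -/
theorem abs_tentη_sub_le (hy0 : 0 < y) (u u' : ℕ → ℝ) {D : ℝ} (hD : |u 0 - u' 0| ≤ D) :
    |(2 + η + max (3 / y ^ 2 - 3 - 3 * (1 + y) / y ^ 2 * |Real.sqrt 3 * u 0 - y|) 0)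
        - (2 + η + max (3 / y ^ 2 - 3 - 3 * (1 + y) / y ^ 2 * |Real.sqrt 3 * u' 0 - y|) 0)| ≤ 3 * Real.sqrt 3 * (1 + y) / y ^ 2 * D := by
  rw [show (2 + η + max (3 / y ^ 2 - 3 - 3 * (1 + y) / y ^ 2 * |Real.sqrt 3 * u 0 - y|) 0)
        - (2 + η + max (3 / y ^ 2 - 3 - 3 * (1 + y) / y ^ 2 * |Real.sqrt 3 * u' 0 - y|) 0)
      = max (3 / y ^ 2 - 3 - 3 * (1 + y) / y ^ 2 * |Real.sqrt 3 * u 0 - y|) 0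
        - max (3 / y ^ 2 - 3 - 3 * (1 + y) / y ^ 2 * |Real.sqrt 3 * u' 0 - y|) 0 by ring]
  exact (abs_tent_sub_tent_le hy0 (u 0) (u' 0)).trans (mul_le_mul_of_nonneg_left hD (by positivity))

/-- The zeroth-moment binder shape of (E37b)∕(E38a)∕(E40) for the raised tent functional. [folklore] -/
theorem zerothMoment_tentη (hy0 : 0 < y) :
    ∀ u u' : ℕ → ℝ, SeqBox 1 u → SeqBox 1 u' → ∀ D : ℝ, (∀ j, |u j - u' j| ≤ D) →
      |(2 + η + max (3 / y ^ 2 - 3 - 3 * (1 + y) / y ^ 2 * |Real.sqrt 3 * u 0 - y|) 0)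
        - (2 + η + max (3 / y ^ 2 - 3 - 3 * (1 + y) / y ^ 2 * |Real.sqrt 3 * u' 0 - y|) 0)| ≤ 3 * Real.sqrt 3 * (1 + y) / y ^ 2 * D :=
  fun u u' _ _ _ hD => abs_tentη_sub_le hy0 u u' (hD 0)

/-- THE DISTANCE TO (E38c)'S FUNCTIONAL on the box: `|φ_y(u₀) − (φ_y(u₀) + η)| = η`. [folklore] -/
theorem abs_tentη_sub_tent (hη : 0 ≤ η) (y : ℝ) (u : ℕ → ℝ) :
    |(fun u : ℕ → ℝ => (fun x : ℝ => (2 : ℝ) + max (3 / y ^ 2 - 3 - 3 * (1 + y) / y ^ 2 * |Real.sqrt 3 * x - y|) 0) (u 0)) u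
        - (2 + η + max (3 / y ^ 2 - 3 - 3 * (1 + y) / y ^ 2 * |Real.sqrt 3 * u 0 - y|) 0)| = η := by
  show |2 + max _ 0 - (2 + η + max _ 0)| = η
  rw [show (2 : ℝ) + max (3 / y ^ 2 - 3 - 3 * (1 + y) / y ^ 2 * |Real.sqrt 3 * u 0 - y|) 0
        - (2 + η + max (3 / y ^ 2 - 3 - 3 * (1 + y) / y ^ 2 * |Real.sqrt 3 * u 0 - y|) 0) = -η by ring, abs_neg, abs_of_nonneg hη]

/-- EXISTENCE of a box solution of the raised flow from the pin `1`, by (E40) `exists_memFlow_zm`. [folklore] -/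
theorem exists_solution_tentη (hy0 : 0 < y) (hη : 0 ≤ η) :
    ∃ h : ℕ → ℝ, SeqBox 1 h ∧ MemFlow (fun u : ℕ → ℝ => 2 + η + max (3 / y ^ 2 - 3 - 3 * (1 + y) / y ^ 2 * |Real.sqrt 3 * u 0 - y|) 0) 1 h :=
  exists_memFlow_zm (γ := 1) (b := 2) (M := 3 * Real.sqrt 3 * (1 + y) / y ^ 2) (zerothMoment_tentη hy0) (by positivity) one_pos le_rfl
    two_pos (fun u _ => two_le_tentη hη y u)

/-! ## §2 The scale-1 step equation of the raised flow has no root in `[y, 1]` -/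

/-- THE STEP EQUATION AT SCALE 1 from the pin `1`: `1∕h(1)² = 1 + (2 + η + tent_y(h(1)))`. [folklore] -/
theorem step_one_tentη (hf : MemFlow (fun u : ℕ → ℝ => 2 + η + max (3 / y ^ 2 - 3 - 3 * (1 + y) / y ^ 2 * |Real.sqrt 3 * u 0 - y|) 0) 1 h) :
    1 / h 1 ^ 2 = 1 + (2 + η + max (3 / y ^ 2 - 3 - 3 * (1 + y) / y ^ 2 * |Real.sqrt 3 * h 1 - y|) 0) := by
  have h0 := hf.2 0
  simp only [zero_add, add_zero] at h0
  rw [hf.1] at h0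
  simpa using h0

/-- THE WINDOW, STRICT: `η > 0` ⟹ `√3·h(1) < 1` (`1∕h(1)² ≥ 3 + η > 3`). [folklore] -/
theorem sqrt3_mul_lt_one (hη : 0 < η) (hh : SeqBox 1 h)
    (hf : MemFlow (fun u : ℕ → ℝ => 2 + η + max (3 / y ^ 2 - 3 - 3 * (1 + y) / y ^ 2 * |Real.sqrt 3 * u 0 - y|) 0) 1 h) :
    Real.sqrt 3 * h 1 < 1 := by
  have h1 := step_one_tentη hf
  have ha := (hh 1).1
  have hmax : 0 ≤ max (3 / y ^ 2 - 3 - 3 * (1 + y) / y ^ 2 * |Real.sqrt 3 * h 1 - y|) 0 := le_max_right _ _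
  have h3 : 3 < 1 / h 1 ^ 2 := by linarith
  have h4 : 3 * h 1 ^ 2 < 1 := by
    rw [lt_div_iff₀ (by positivity)] at h3
    linarith
  have h5 : (Real.sqrt 3 * h 1) ^ 2 < 1 := by
    rw [mul_pow, Real.sq_sqrt (by norm_num : (0 : ℝ) ≤ 3)]
    linarith
  nlinarith [mul_nonneg (Real.sqrt_nonneg 3) ha.le]

/-- ON `[y, 1]` THE TENT IS THE CHORD `3(1+y)(1−s)∕y²` (`s = √3·x`): there `|s − y| = s − y` and the height `3∕y² − 3 = 3(1+y)(1−y)∕y²` minus the slope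
part is `≥ 0`. [folklore] -/
theorem tent_eq_chord (hy0 : 0 < y) {s : ℝ} (hys : y ≤ s) (hs1 : s ≤ 1) :
    max (3 / y ^ 2 - 3 - 3 * (1 + y) / y ^ 2 * |s - y|) 0 = 3 * (1 + y) * (1 - s) / y ^ 2 := by
  rw [abs_of_nonneg (sub_nonneg.2 hys)]
  have e : 3 / y ^ 2 - 3 - 3 * (1 + y) / y ^ 2 * (s - y) = 3 * (1 + y) * (1 - s) / y ^ 2 := by
    field_simp
    ring
  rw [e]
  exact max_eq_left (div_nonneg (mul_nonneg (by positivity) (sub_nonneg.2 hs1)) (sq_nonneg y))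

/-- **THE CONVEX SIDE OF THE CHORD**: `0 < y ≤ s ≤ 1` ⟹ `3∕s² − 3 ≤ 3(1+y)(1−s)∕y²` — `(1+s)∕s² ≤ (1+y)∕y²` for `s ≥ y`
(`(1+y)s² − (1+s)y² = (s − y)(s + y + sy) ≥ 0`). [folklore] -/
theorem chord_ge (hy0 : 0 < y) {s : ℝ} (hys : y ≤ s) (hs1 : s ≤ 1) : 3 / s ^ 2 - 3 ≤ 3 * (1 + y) * (1 - s) / y ^ 2 := by
  have hs0 : 0 < s := hy0.trans_le hys
  rw [div_sub' (by positivity), div_le_div_iff₀ (by positivity) (by positivity)]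
  -- `(3 − 3s²)·y² ≤ 3(1+y)(1−s)·s²`
  have hsum : 0 < s + y + s * y := by positivity
  have key : 0 ≤ (1 - s) * ((s - y) * (s + y + s * y)) := mul_nonneg (sub_nonneg.2 hs1) (mul_nonneg (sub_nonneg.2 hys) hsum.le)
  nlinarith [key]

/-- **NO ROOT IN `[y, 1]`**: every box solution of the raised flow (`η > 0`) from the pin `1` has `√3·h(1) < y` — on `[y,1]` the step equation would read
`3∕s² − 3 − 3(1+y)(1−s)∕y² = η > 0`, against `chord_ge`. [folklore] -/
theorem sqrt3_mul_lt_of_shift (hy0 : 0 < y) (hη : 0 < η) (hh : SeqBox 1 h)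
    (hf : MemFlow (fun u : ℕ → ℝ => 2 + η + max (3 / y ^ 2 - 3 - 3 * (1 + y) / y ^ 2 * |Real.sqrt 3 * u 0 - y|) 0) 1 h) :
    Real.sqrt 3 * h 1 < y := by
  by_contra hcon
  push Not at hcon
  have h1 := step_one_tentη hf
  have hs1 := sqrt3_mul_lt_one hη hh hf
  set s := Real.sqrt 3 * h 1 with hs
  have hs0 : 0 < s := mul_pos (Real.sqrt_pos.2 (by norm_num)) (hh 1).1
  have ha := (hh 1).1.ne'
  rw [tent_eq_chord hy0 hcon hs1.le] at h1
  have e : 3 / s ^ 2 = 1 / h 1 ^ 2 := by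
    rw [hs, mul_pow, Real.sq_sqrt (by norm_num : (0 : ℝ) ≤ 3)]
    field_simp
  have hch := chord_ge hy0 hcon hs1.le
  rw [e] at hch
  linarith

/-! ## §3 ENDs: the edge solution is destroyed by every upward perturbation -/

/-- **EVERY SOLUTION OF THE RAISED FLOW IS `(1 − y)∕√3`-AWAY FROM `hSlow` AT SCALE 1** (`9∕10 ≤ y < 1` not even needed: `0 < y`, `η > 0`):
`hSlow(1) − h(1) > (1 − y)∕√3` — since `√3·hSlow(1) = 1` ((E38c)) and `√3·h(1) < y`. [folklore] -/
theorem hSlow_sub_gt_of_shift (hy0 : 0 < y) (hη : 0 < η) (hh : SeqBox 1 h)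
    (hf : MemFlow (fun u : ℕ → ℝ => 2 + η + max (3 / y ^ 2 - 3 - 3 * (1 + y) / y ^ 2 * |Real.sqrt 3 * u 0 - y|) 0) 1 h) :
    (1 - y) / Real.sqrt 3 < hSlow 1 - h 1 := by
  have h30 : (0 : ℝ) < Real.sqrt 3 := Real.sqrt_pos.2 (by norm_num)
  have hlt := sqrt3_mul_lt_of_shift hy0 hη hh hf
  have he := sqrt3_mul_hSlow_one
  rw [div_lt_iff₀ h30]
  nlinarith

/-- **THE SOLUTION SET IS NOT LOWER SEMICONTINUOUS ABOVE THE THRESHOLD.**  For (E38c)'s tent `φ_y` (`9∕10 ≤ y < 1`; ratio `M·γ∕b = 3√3(1+y)∕(2y²) > 3√3`):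
`hSlow` is a box solution of the flow of `φ_y` from the pin `1`; for EVERY `η > 0` the raised functional `φ_y + η` is `η`-close to `φ_y` on the box, has
the same floor and zeroth moment, its flow from the pin `1` HAS box solutions ((E40)), and EVERY one of them satisfies `hSlow(1) − h′(1) > (1 − y)∕√3`:
no solution of the perturbed flow approaches `hSlow` as `η ↓ 0`.  (By (E47a) `abs_sub_le_usc_modulus` they all stay within `γ(1−1∕q) + √(γF∕q)` of the
unperturbed solution SET — i.e. near the other solution `hF_y`.) [folklore] -/
theorem not_lsc_at_tent (hy9 : 9 / 10 ≤ y) (hy1 : y < 1) :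
    MemFlow (fun u : ℕ → ℝ => (fun x : ℝ => (2 : ℝ) + max (3 / y ^ 2 - 3 - 3 * (1 + y) / y ^ 2 * |Real.sqrt 3 * x - y|) 0) (u 0)) 1 hSlow ∧
    ∀ η : ℝ, 0 < η →
      (∀ u : ℕ → ℝ, |(fun u : ℕ → ℝ => (fun x : ℝ => (2 : ℝ) + max (3 / y ^ 2 - 3 - 3 * (1 + y) / y ^ 2 * |Real.sqrt 3 * x - y|) 0) (u 0)) u
          - (2 + η + max (3 / y ^ 2 - 3 - 3 * (1 + y) / y ^ 2 * |Real.sqrt 3 * u 0 - y|) 0)| = η) ∧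
      (∃ h : ℕ → ℝ, SeqBox 1 h ∧
          MemFlow (fun u : ℕ → ℝ => 2 + η + max (3 / y ^ 2 - 3 - 3 * (1 + y) / y ^ 2 * |Real.sqrt 3 * u 0 - y|) 0) 1 h) ∧
      ∀ h : ℕ → ℝ, SeqBox 1 h →
          MemFlow (fun u : ℕ → ℝ => 2 + η + max (3 / y ^ 2 - 3 - 3 * (1 + y) / y ^ 2 * |Real.sqrt 3 * u 0 - y|) 0) 1 h →
            (1 - y) / Real.sqrt 3 < hSlow 1 - h 1 := by
  have hy0 : 0 < y := by linarith
  exact ⟨memFlow_hSlow_tentφ hy0 hy9 hy1.le, fun η hη =>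
    ⟨fun u => abs_tentη_sub_tent hη.le y u, exists_solution_tentη hy0 hη.le, fun h hh hf => hSlow_sub_gt_of_shift hy0 hη hh hf⟩⟩

end Summit.QuantumFields.BalabanUV.Beta.EriceRemainderEnclosureHistoryAutonomyThresholdEdgeUnstable

end
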